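import Summits.Ventures.YMGap.RobustBall.RobustAreaLawPairW
import Summits.Ventures.YMGap.RobustBall.RowsSU3Certified
import HarnessLib

/-!
# Venture YMGap, track Y2 ROBUST-BALL — HYPOTHESIS-FREE `SU(3)` AREA-LAW ROWS through the Holley–Stroock PAIR door on the Bakry–Émery pair,
# tier 1 (finite range) AND tier 2 (diameter-weighted), `d = 4` and `d = 3`: the class-K baseline of the `SU(3)` area-law columns

HONEST FRAMING.  Venture file of the cell `pub-ymgap` (QuantumFields programme), seat engine-2 (g7).  Strong-coupling LATTICE statements
only: `SU(3)` lattice Yang–Mills on the tori `(ℤ/L)^d` (uniform in `L`), Wilson's action at tree coupling `β_W/3` plus a member of rb-theory's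
tier-1 ball `ClusterDomainFR ε₀ ε₁ r` (conclusion `RobustBall.AreaLawOnBall 3 d (β_W/3) ε₀ ε₁ r mv`, ∀ r, ∀ mv ≥ 1) resp. tier-2 ball
`ClusterDomain κ ε₀ ε₁` (conclusion `RobustBall.AreaLawOnBallW 3 d (β_W/3) κ ε₀ ε₁ mv`, ∀ mv ≥ 1, no range cut-off), each with vertical dependence
diameter `mv`.  Nothing about the continuum, an infinite-volume string tension, weak coupling, a mass gap, or Clay.  HYPOTHESIS-FREE (class K
outright): kernel arithmetic over ds-4's all-`N` pair schemas `RobustBall.suN_areaLawOnBall_bakryEmery` / `suN_areaLawOnBallW_bakryEmery`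
(engine-2's pair slab door `areaLawOnBall_of_pair` and its weighted twin, fed with the TREE's Bakry–Émery one-link pair
`(c, v) = (1/(N(1/2 − R)), N/(1/2 − R))`, `oneLinkPoincareSUN_bakryEmery` / `oneLinkVarianceBound_bakryEmery`) SPECIALISED TO `N = 3`
('t Hooft `β_W/9`, slab radius `R = 2n·β_W/9`, row condition `[e^{κ/n}]·e^{ε₀}R/(1/2 − R) + e^{ε₀/2}ε₁/√(3(1/2 − R)) < 1`).
WHY A SEPARATE FILE: ds-4's numeric all-`N` rows are certified at the worst case `N = 2` and at `N`-uniform 't Hooft radii; at `N = 3` the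
cross leg `1/√(3(1/2 − R))` is smaller and the cells below are the `SU(3)`-specific ones.  They SUPERSEDE the tier-1 class-K baseline of
`AreaLawRowsSU3Free` (engine-2 g6: p2's first-order modulus `K₁` through the affine-vertex door): at every grid coupling the Bakry–Émery PAIR
through the pair door gives a larger radius (`d = 4`: `(1/8, .407)` vs `.388`, `(1/5, .283)` vs `.259`, `(1/4, .203)` vs `.159`, `(3/10, .123)`
vs `.080`, `(1/3, .069)` vs `.042`), because the pair door carries no self-Lipschitz load and its cross leg is `√(e^{ε₀}c)` instead of `√N`.
The CERTIFIED-pair rows (`AreaLawRowsPair`, `AreaLawRowsPairW`; classes K × C…) lie above these; these say what the certificates buy.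

THE ROWS (one-parameter convention `ε₀ = 2ε`, `ε₁ = ε`; `ε` at `1/1000`, rounded down; exact rational certificates with
`e^x ≤ T(x) = 1 + x + x²/2 + x³/6 + (5/96)x⁴` on `[0,1]`, a rational `s₀ ≤ √(3(1/2 − R))` checked by squaring, `(6/5)^{1/3} ≤ 1.0627`,
`(6/5)^{1/2} ≤ 1.0955`):
* `d = 4` (`R = 2β_W/3 < 1/2`, i.e. `β_W < 3/4`; Wilson threshold of the door `β_W = 3/8`): TIER 1 `(β⋆_W, ε) = (1/8, .407) (1/6, .337) (1/5, .283)
  (1/4, .203) (3/10, .123) (1/3, .069)`; TIER 2, `κ = log(6/5)`: `(1/8, .397) (1/6, .325) (1/5, .269) (1/4, .187) (3/10, .105) (1/3, .050)`.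
* `d = 3` (`R = 4β_W/9`; threshold `9/16`): TIER 1 `(1/4, .337) (1/3, .247) (2/5, .176) (1/2, .069)`; TIER 2, `κ = log(6/5)`:
  `(1/4, .319) (1/3, .225) (2/5, .152) (1/2, .041)`.
-/

noncomputable section

open MeasureTheory ProbabilityTheory Real
open Literature.MathematicalPhysics.QuantumFieldTheory
open Summit.Ventures.YMGap.RobustBall
  (AreaLawOnBall AreaLawOnBallW suN_areaLawOnBall_bakryEmery suN_areaLawOnBallW_bakryEmery suN_row_lt_one_of_bounds
    exp_log_six_fifths_div_three_le exp_log_six_fifths_div_two_le)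

namespace Summit.Ventures.YMGap.RobustBallSU3

variable {n : ℕ}

/-! ### 1. The `N = 3` specialisation of the all-`N` Bakry–Émery pair schemas (Wilson units) -/

/-- `s₀ ≤ √(3 D)` from `s₀² ≤ 3 D`, `0 ≤ s₀`. [folklore] -/
theorem le_sqrt_three_mul {D s₀ : ℝ} (hs₀ : 0 ≤ s₀) (h : s₀ ^ 2 ≤ 3 * D) :
    s₀ ≤ Real.sqrt (((3 : ℕ) : ℝ) * D) := by
  rw [Nat.cast_ofNat]
  calc s₀ = Real.sqrt (s₀ ^ 2) := by rw [Real.sqrt_sq hs₀]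
    _ ≤ Real.sqrt (3 * D) := Real.sqrt_le_sqrt h

/-- **`SU(3)`, every `d = n + 1`, HYPOTHESIS-FREE, TIER 1: area law on the ball from the Bakry–Émery pair through the pair door.**  With
`R = 2n·|β_W|/9 < 1/2`: `e^{ε₀}R/(1/2 − R) + e^{ε₀/2}ε₁/√(3(1/2 − R)) < 1 ⇒ AreaLawOnBall 3 (n+1) (β_W/3) ε₀ ε₁ r mv` for every range `r` and
`mv ≥ 1` (ds-4's `suN_areaLawOnBall_bakryEmery` at `N = 3`, 't Hooft coupling `β_W/9`). [cite: arXiv220412737, Lemma 4.1 and Rem. 1.3] -/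
theorem su3_areaLawOnBall_bePair {βW ε₀ ε₁ : ℝ} (h₁ : 0 ≤ ε₁) (hb : |βW| / 9 * (2 * (n : ℝ)) < 1 / 2) (r : ℕ) {mv : ℕ}
    (hmv : 1 ≤ mv)
    (hρ : exp ε₀ * (|βW| / 9 * (2 * (n : ℝ))) / (1 / 2 - |βW| / 9 * (2 * (n : ℝ))) +
      exp (ε₀ / 2) * ε₁ / Real.sqrt (((3 : ℕ) : ℝ) * (1 / 2 - |βW| / 9 * (2 * (n : ℝ)))) < 1) :
    AreaLawOnBall 3 (n + 1) (βW / 3) ε₀ ε₁ r mv := by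
  have habs : |βW / 9| = |βW| / 9 := by rw [abs_div, abs_of_pos (by norm_num : (0 : ℝ) < 9)]
  have e : ((3 : ℕ) : ℝ) * (βW / 9) = βW / 3 := by push_cast; ring
  have h := suN_areaLawOnBall_bakryEmery (N := 3) (n := n) (βt := βW / 9) (by norm_num) h₁ (by rw [habs]; exact hb) r hmv
    (by rw [habs]; exact hρ)
  rwa [e] at h

/-- **`SU(3)`, every `d = n + 1`, HYPOTHESIS-FREE, TIER 2: area law on the diameter-weighted ball from the Bakry–Émery pair.**  With
`R = 2n·|β_W|/9 < 1/2`, `n ≥ 1`, `κ > 0`: `e^{κ/n}(e^{ε₀}R/(1/2 − R)) + e^{ε₀/2}ε₁/√(3(1/2 − R)) < 1 ⇒ AreaLawOnBallW 3 (n+1) (β_W/3) κ ε₀ ε₁ mv`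
for every `mv ≥ 1` (ds-4's `suN_areaLawOnBallW_bakryEmery` at `N = 3`). [cite: arXiv220412737, Lemma 4.1 and Rem. 1.3] -/
theorem su3_areaLawOnBallW_bePair {βW κ ε₀ ε₁ : ℝ} (hn : 1 ≤ n) (hκ : 0 < κ) (hb : |βW| / 9 * (2 * (n : ℝ)) < 1 / 2) {mv : ℕ}
    (hmv : 1 ≤ mv)
    (hρ : exp (κ / n) * (exp ε₀ * (|βW| / 9 * (2 * (n : ℝ))) / (1 / 2 - |βW| / 9 * (2 * (n : ℝ)))) +
      exp (ε₀ / 2) * ε₁ / Real.sqrt (((3 : ℕ) : ℝ) * (1 / 2 - |βW| / 9 * (2 * (n : ℝ)))) < 1) :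
    AreaLawOnBallW 3 (n + 1) (βW / 3) κ ε₀ ε₁ mv := by
  have habs : |βW / 9| = |βW| / 9 := by rw [abs_div, abs_of_pos (by norm_num : (0 : ℝ) < 9)]
  have e : ((3 : ℕ) : ℝ) * (βW / 9) = βW / 3 := by push_cast; ring
  have h := suN_areaLawOnBallW_bakryEmery (N := 3) (n := n) (βt := βW / 9) (by norm_num) hn hκ (by rw [habs]; exact hb) hmv
    (by rw [habs]; exact hρ)
  rwa [e] at h

/-! ### 2. `d = 4` row schemas and rows (slice dimension `n = 3`, `R = 2β_W/3`) -/

/-- **`SU(3)`, `d = 4`, HYPOTHESIS-FREE TIER-1 row schema (pair door, Bakry–Émery pair)**: `0 ≤ β_W < 3/4`, `0 ≤ ε ≤ 1/2`, a rational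
`0 < s₀` with `s₀² ≤ 3(1/2 − 2β_W/3)`, and the RATIONAL certificate `T(2ε)(2β_W/3)/(1/2 − 2β_W/3) + T(ε)ε/s₀ < 1` give
`AreaLawOnBall 3 4 (β_W/3) (2ε) ε r mv`. [folklore] -/
theorem su3_freePairRow4 (r : ℕ) {mv : ℕ} (hmv : 1 ≤ mv) {βW ε s₀ : ℝ} (hβ0 : 0 ≤ βW) (hβ : βW < 3 / 4) (hε0 : 0 ≤ ε)
    (hε1 : ε ≤ 1 / 2) (hs₀ : 0 < s₀) (hs : s₀ ^ 2 ≤ 3 * (1 / 2 - 2 * βW / 3))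
    (hcert : (1 + 2 * ε + (2 * ε) ^ 2 / 2 + (2 * ε) ^ 3 / 6 + 5 / 96 * (2 * ε) ^ 4) * ((2 * βW / 3) / (1 / 2 - 2 * βW / 3)) +
      (1 + ε + ε ^ 2 / 2 + ε ^ 3 / 6 + 5 / 96 * ε ^ 4) * ε / s₀ < 1) :
    AreaLawOnBall 3 4 (βW / 3) (2 * ε) ε r mv := by
  show AreaLawOnBall 3 (3 + 1) (βW / 3) (2 * ε) ε r mv
  have hR : |βW| / 9 * (2 * ((3 : ℕ) : ℝ)) = 2 * βW / 3 := by rw [abs_of_nonneg hβ0]; push_cast; ring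
  refine su3_areaLawOnBall_bePair (n := 3) hε0 (by rw [hR]; linarith) r hmv ?_
  rw [hR]
  have hEh : exp (2 * ε / 2) ≤ 1 + ε + ε ^ 2 / 2 + ε ^ 3 / 6 + 5 / 96 * ε ^ 4 := by
    rw [show 2 * ε / 2 = ε by ring]; exact exp_le_taylor4 hε0 (by linarith)
  have h := suN_row_lt_one_of_bounds (w := 0) (ε₁ := ε) (q := (2 * βW / 3) / (1 / 2 - 2 * βW / 3)) (E₃ := 1)
    (div_nonneg (by positivity) (by linarith)) hε0 (by rw [Real.exp_zero]) (exp_le_taylor4 (by linarith) (by linarith)) hEh hs₀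
    (le_sqrt_three_mul hs₀.le hs) (by rw [one_mul]; exact hcert)
  rw [Real.exp_zero, one_mul] at h
  calc exp (2 * ε) * (2 * βW / 3) / (1 / 2 - 2 * βW / 3) + exp (2 * ε / 2) * ε / Real.sqrt (((3 : ℕ) : ℝ) * (1 / 2 - 2 * βW / 3))
      = exp (2 * ε) * ((2 * βW / 3) / (1 / 2 - 2 * βW / 3)) +
          exp (2 * ε / 2) * ε / Real.sqrt (((3 : ℕ) : ℝ) * (1 / 2 - 2 * βW / 3)) := by ring
    _ < 1 := h

/-- **`SU(3)`, `d = 4`, HYPOTHESIS-FREE TIER-2 row schema (weighted pair door, Bakry–Émery pair)**: as `su3_freePairRow4` with a weight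
`κ > 0`, `e^{κ/3} ≤ E_w`, and the certificate `E_w(T(2ε)(2β_W/3)/(1/2 − 2β_W/3)) + T(ε)ε/s₀ < 1`: `AreaLawOnBallW 3 4 (β_W/3) κ (2ε) ε mv`.
[folklore] -/
theorem su3_freePairRowW4 {mv : ℕ} (hmv : 1 ≤ mv) {βW κ ε s₀ Ew : ℝ} (hβ0 : 0 ≤ βW) (hβ : βW < 3 / 4) (hκ : 0 < κ)
    (hEw : exp (κ / 3) ≤ Ew) (hε0 : 0 ≤ ε) (hε1 : ε ≤ 1 / 2) (hs₀ : 0 < s₀) (hs : s₀ ^ 2 ≤ 3 * (1 / 2 - 2 * βW / 3))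
    (hcert : Ew * ((1 + 2 * ε + (2 * ε) ^ 2 / 2 + (2 * ε) ^ 3 / 6 + 5 / 96 * (2 * ε) ^ 4) *
        ((2 * βW / 3) / (1 / 2 - 2 * βW / 3))) +
      (1 + ε + ε ^ 2 / 2 + ε ^ 3 / 6 + 5 / 96 * ε ^ 4) * ε / s₀ < 1) :
    AreaLawOnBallW 3 4 (βW / 3) κ (2 * ε) ε mv := by
  show AreaLawOnBallW 3 (3 + 1) (βW / 3) κ (2 * ε) ε mv
  have hR : |βW| / 9 * (2 * ((3 : ℕ) : ℝ)) = 2 * βW / 3 := by rw [abs_of_nonneg hβ0]; push_cast; ring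
  refine su3_areaLawOnBallW_bePair (n := 3) (by norm_num) hκ (by rw [hR]; linarith) hmv ?_
  rw [hR]
  have hEh : exp (2 * ε / 2) ≤ 1 + ε + ε ^ 2 / 2 + ε ^ 3 / 6 + 5 / 96 * ε ^ 4 := by
    rw [show 2 * ε / 2 = ε by ring]; exact exp_le_taylor4 hε0 (by linarith)
  have h := suN_row_lt_one_of_bounds (w := κ / 3) (ε₁ := ε) (q := (2 * βW / 3) / (1 / 2 - 2 * βW / 3))
    (div_nonneg (by positivity) (by linarith)) hε0 hEw (exp_le_taylor4 (by linarith) (by linarith)) hEh hs₀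
    (le_sqrt_three_mul hs₀.le hs) hcert
  calc exp (κ / ((3 : ℕ) : ℝ)) * (exp (2 * ε) * (2 * βW / 3) / (1 / 2 - 2 * βW / 3)) +
        exp (2 * ε / 2) * ε / Real.sqrt (((3 : ℕ) : ℝ) * (1 / 2 - 2 * βW / 3))
      = exp (κ / 3) * (exp (2 * ε) * ((2 * βW / 3) / (1 / 2 - 2 * βW / 3))) +
          exp (2 * ε / 2) * ε / Real.sqrt (((3 : ℕ) : ℝ) * (1 / 2 - 2 * βW / 3)) := by push_cast; ring
    _ < 1 := h

/-- TIER-1 row `(β⋆_W, ε) = (1/8, 0.407)`, `d = 4`, hypothesis-free: `AreaLawOnBall 3 4 ((1/8)/3) 0.814 0.407 r mv` (`R = 1/12`, `s₀ = 1.118`;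
`AreaLawRowsSU3Free`'s `K₁`-vertex row: `0.388`; the certified-pair vertex row: `0.421`). [folklore] -/
theorem su3_freePairRow4_1_8 (r : ℕ) {mv : ℕ} (hmv : 1 ≤ mv) :
    AreaLawOnBall 3 4 ((1 / 8 : ℝ) / 3) (2 * (407 / 1000)) (407 / 1000) r mv :=
  su3_freePairRow4 r hmv (s₀ := 559 / 500) (by norm_num) (by norm_num) (by norm_num) (by norm_num) (by norm_num) (by norm_num)
    (by norm_num)

/-- TIER-1 row `(1/6, 0.337)`, `d = 4`, hypothesis-free (`R = 1/9`, `s₀ = 1.0801`). [folklore] -/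
theorem su3_freePairRow4_1_6 (r : ℕ) {mv : ℕ} (hmv : 1 ≤ mv) :
    AreaLawOnBall 3 4 ((1 / 6 : ℝ) / 3) (2 * (337 / 1000)) (337 / 1000) r mv :=
  su3_freePairRow4 r hmv (s₀ := 10801 / 10000) (by norm_num) (by norm_num) (by norm_num) (by norm_num) (by norm_num)
    (by norm_num) (by norm_num)

/-- TIER-1 row `(1/5, 0.283)`, `d = 4`, hypothesis-free (`R = 2/15`, `s₀ = 1.0488`; `K₁`-vertex row: `0.259`). [folklore] -/
theorem su3_freePairRow4_1_5 (r : ℕ) {mv : ℕ} (hmv : 1 ≤ mv) :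
    AreaLawOnBall 3 4 ((1 / 5 : ℝ) / 3) (2 * (283 / 1000)) (283 / 1000) r mv :=
  su3_freePairRow4 r hmv (s₀ := 1311 / 1250) (by norm_num) (by norm_num) (by norm_num) (by norm_num) (by norm_num)
    (by norm_num) (by norm_num)

/-- TIER-1 row `(1/4, 0.203)`, `d = 4`, hypothesis-free (`R = 1/6`, `s₀ = 1`; `K₁`-vertex row: `0.159`; certified-pair rows: `0.321` / `0.381`).
[folklore] -/
theorem su3_freePairRow4_1_4 (r : ℕ) {mv : ℕ} (hmv : 1 ≤ mv) :
    AreaLawOnBall 3 4 ((1 / 4 : ℝ) / 3) (2 * (203 / 1000)) (203 / 1000) r mv :=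
  su3_freePairRow4 r hmv (s₀ := 1) (by norm_num) (by norm_num) (by norm_num) (by norm_num) (by norm_num) (by norm_num)
    (by norm_num)

/-- TIER-1 row `(3/10, 0.123)`, `d = 4`, hypothesis-free (`R = 1/5`, `s₀ = 0.9486`; `K_BE`-vertex row: `0.080`). [folklore] -/
theorem su3_freePairRow4_3_10 (r : ℕ) {mv : ℕ} (hmv : 1 ≤ mv) :
    AreaLawOnBall 3 4 ((3 / 10 : ℝ) / 3) (2 * (123 / 1000)) (123 / 1000) r mv :=
  su3_freePairRow4 r hmv (s₀ := 4743 / 5000) (by norm_num) (by norm_num) (by norm_num) (by norm_num) (by norm_num)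
    (by norm_num) (by norm_num)

/-- TIER-1 row `(1/3, 0.069)`, `d = 4`, hypothesis-free (`R = 2/9`, `s₀ = 0.9128`; `K_BE`-vertex row: `0.042`). [folklore] -/
theorem su3_freePairRow4_1_3 (r : ℕ) {mv : ℕ} (hmv : 1 ≤ mv) :
    AreaLawOnBall 3 4 ((1 / 3 : ℝ) / 3) (2 * (69 / 1000)) (69 / 1000) r mv :=
  su3_freePairRow4 r hmv (s₀ := 1141 / 1250) (by norm_num) (by norm_num) (by norm_num) (by norm_num) (by norm_num)
    (by norm_num) (by norm_num)

/-- TIER-2 row `(β⋆_W, κ, ε) = (1/8, log(6/5), 0.397)`, `d = 4`, hypothesis-free: `AreaLawOnBallW 3 4 ((1/8)/3) (log(6/5)) 0.794 0.397 mv`.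
[folklore] -/
theorem su3_freePairRowW4_1_8_w65 {mv : ℕ} (hmv : 1 ≤ mv) :
    AreaLawOnBallW 3 4 ((1 / 8 : ℝ) / 3) (Real.log (6 / 5)) (2 * (397 / 1000)) (397 / 1000) mv :=
  su3_freePairRowW4 hmv (s₀ := 559 / 500) (by norm_num) (by norm_num) (Real.log_pos (by norm_num)) exp_log_six_fifths_div_three_le
    (by norm_num) (by norm_num) (by norm_num) (by norm_num) (by norm_num)

/-- TIER-2 row `(1/6, log(6/5), 0.325)`, `d = 4`, hypothesis-free. [folklore] -/
theorem su3_freePairRowW4_1_6_w65 {mv : ℕ} (hmv : 1 ≤ mv) :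
    AreaLawOnBallW 3 4 ((1 / 6 : ℝ) / 3) (Real.log (6 / 5)) (2 * (13 / 40)) (13 / 40) mv :=
  su3_freePairRowW4 hmv (s₀ := 10801 / 10000) (by norm_num) (by norm_num) (Real.log_pos (by norm_num))
    exp_log_six_fifths_div_three_le (by norm_num) (by norm_num) (by norm_num) (by norm_num) (by norm_num)

/-- TIER-2 row `(1/5, log(6/5), 0.269)`, `d = 4`, hypothesis-free. [folklore] -/
theorem su3_freePairRowW4_1_5_w65 {mv : ℕ} (hmv : 1 ≤ mv) :
    AreaLawOnBallW 3 4 ((1 / 5 : ℝ) / 3) (Real.log (6 / 5)) (2 * (269 / 1000)) (269 / 1000) mv :=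
  su3_freePairRowW4 hmv (s₀ := 1311 / 1250) (by norm_num) (by norm_num) (Real.log_pos (by norm_num))
    exp_log_six_fifths_div_three_le (by norm_num) (by norm_num) (by norm_num) (by norm_num) (by norm_num)

/-- TIER-2 row `(1/4, log(6/5), 0.187)`, `d = 4`, hypothesis-free (ds-4's `SU(2)` tier-2 rows at the same `β_W`: `.21` / `.21`). [folklore] -/
theorem su3_freePairRowW4_1_4_w65 {mv : ℕ} (hmv : 1 ≤ mv) :
    AreaLawOnBallW 3 4 ((1 / 4 : ℝ) / 3) (Real.log (6 / 5)) (2 * (187 / 1000)) (187 / 1000) mv :=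
  su3_freePairRowW4 hmv (s₀ := 1) (by norm_num) (by norm_num) (Real.log_pos (by norm_num)) exp_log_six_fifths_div_three_le
    (by norm_num) (by norm_num) (by norm_num) (by norm_num) (by norm_num)

/-- TIER-2 row `(3/10, log(6/5), 0.105)`, `d = 4`, hypothesis-free. [folklore] -/
theorem su3_freePairRowW4_3_10_w65 {mv : ℕ} (hmv : 1 ≤ mv) :
    AreaLawOnBallW 3 4 ((3 / 10 : ℝ) / 3) (Real.log (6 / 5)) (2 * (21 / 200)) (21 / 200) mv :=
  su3_freePairRowW4 hmv (s₀ := 4743 / 5000) (by norm_num) (by norm_num) (Real.log_pos (by norm_num))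
    exp_log_six_fifths_div_three_le (by norm_num) (by norm_num) (by norm_num) (by norm_num) (by norm_num)

/-- TIER-2 row `(1/3, log(6/5), 0.050)`, `d = 4`, hypothesis-free (the door's weighted Wilson threshold is `β_W ≈ 0.364`). [folklore] -/
theorem su3_freePairRowW4_1_3_w65 {mv : ℕ} (hmv : 1 ≤ mv) :
    AreaLawOnBallW 3 4 ((1 / 3 : ℝ) / 3) (Real.log (6 / 5)) (2 * (1 / 20)) (1 / 20) mv :=
  su3_freePairRowW4 hmv (s₀ := 1141 / 1250) (by norm_num) (by norm_num) (Real.log_pos (by norm_num))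
    exp_log_six_fifths_div_three_le (by norm_num) (by norm_num) (by norm_num) (by norm_num) (by norm_num)

/-! ### 3. `d = 3` row schemas and rows (slice dimension `n = 2`, `R = 4β_W/9`; Y2 table entries) -/

/-- **`SU(3)`, `d = 3`, HYPOTHESIS-FREE TIER-1 row schema**: `0 ≤ β_W < 9/8`, `0 ≤ ε ≤ 1/2`, `0 < s₀`, `s₀² ≤ 3(1/2 − 4β_W/9)` and
`T(2ε)(4β_W/9)/(1/2 − 4β_W/9) + T(ε)ε/s₀ < 1` give `AreaLawOnBall 3 3 (β_W/3) (2ε) ε r mv`. [folklore] -/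
theorem su3_freePairRow3 (r : ℕ) {mv : ℕ} (hmv : 1 ≤ mv) {βW ε s₀ : ℝ} (hβ0 : 0 ≤ βW) (hβ : βW < 9 / 8) (hε0 : 0 ≤ ε)
    (hε1 : ε ≤ 1 / 2) (hs₀ : 0 < s₀) (hs : s₀ ^ 2 ≤ 3 * (1 / 2 - 4 * βW / 9))
    (hcert : (1 + 2 * ε + (2 * ε) ^ 2 / 2 + (2 * ε) ^ 3 / 6 + 5 / 96 * (2 * ε) ^ 4) * ((4 * βW / 9) / (1 / 2 - 4 * βW / 9)) +
      (1 + ε + ε ^ 2 / 2 + ε ^ 3 / 6 + 5 / 96 * ε ^ 4) * ε / s₀ < 1) :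
    AreaLawOnBall 3 3 (βW / 3) (2 * ε) ε r mv := by
  show AreaLawOnBall 3 (2 + 1) (βW / 3) (2 * ε) ε r mv
  have hR : |βW| / 9 * (2 * ((2 : ℕ) : ℝ)) = 4 * βW / 9 := by rw [abs_of_nonneg hβ0]; push_cast; ring
  refine su3_areaLawOnBall_bePair (n := 2) hε0 (by rw [hR]; linarith) r hmv ?_
  rw [hR]
  have hEh : exp (2 * ε / 2) ≤ 1 + ε + ε ^ 2 / 2 + ε ^ 3 / 6 + 5 / 96 * ε ^ 4 := by
    rw [show 2 * ε / 2 = ε by ring]; exact exp_le_taylor4 hε0 (by linarith)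
  have h := suN_row_lt_one_of_bounds (w := 0) (ε₁ := ε) (q := (4 * βW / 9) / (1 / 2 - 4 * βW / 9)) (E₃ := 1)
    (div_nonneg (by positivity) (by linarith)) hε0 (by rw [Real.exp_zero]) (exp_le_taylor4 (by linarith) (by linarith)) hEh hs₀
    (le_sqrt_three_mul hs₀.le hs) (by rw [one_mul]; exact hcert)
  rw [Real.exp_zero, one_mul] at h
  calc exp (2 * ε) * (4 * βW / 9) / (1 / 2 - 4 * βW / 9) + exp (2 * ε / 2) * ε / Real.sqrt (((3 : ℕ) : ℝ) * (1 / 2 - 4 * βW / 9))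
      = exp (2 * ε) * ((4 * βW / 9) / (1 / 2 - 4 * βW / 9)) +
          exp (2 * ε / 2) * ε / Real.sqrt (((3 : ℕ) : ℝ) * (1 / 2 - 4 * βW / 9)) := by ring
    _ < 1 := h

/-- **`SU(3)`, `d = 3`, HYPOTHESIS-FREE TIER-2 row schema** (`κ > 0`, `e^{κ/2} ≤ E_w`): `E_w(T(2ε)(4β_W/9)/(1/2 − 4β_W/9)) + T(ε)ε/s₀ < 1 ⇒
AreaLawOnBallW 3 3 (β_W/3) κ (2ε) ε mv`. [folklore] -/
theorem su3_freePairRowW3 {mv : ℕ} (hmv : 1 ≤ mv) {βW κ ε s₀ Ew : ℝ} (hβ0 : 0 ≤ βW) (hβ : βW < 9 / 8) (hκ : 0 < κ)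
    (hEw : exp (κ / 2) ≤ Ew) (hε0 : 0 ≤ ε) (hε1 : ε ≤ 1 / 2) (hs₀ : 0 < s₀) (hs : s₀ ^ 2 ≤ 3 * (1 / 2 - 4 * βW / 9))
    (hcert : Ew * ((1 + 2 * ε + (2 * ε) ^ 2 / 2 + (2 * ε) ^ 3 / 6 + 5 / 96 * (2 * ε) ^ 4) *
        ((4 * βW / 9) / (1 / 2 - 4 * βW / 9))) +
      (1 + ε + ε ^ 2 / 2 + ε ^ 3 / 6 + 5 / 96 * ε ^ 4) * ε / s₀ < 1) :
    AreaLawOnBallW 3 3 (βW / 3) κ (2 * ε) ε mv := by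
  show AreaLawOnBallW 3 (2 + 1) (βW / 3) κ (2 * ε) ε mv
  have hR : |βW| / 9 * (2 * ((2 : ℕ) : ℝ)) = 4 * βW / 9 := by rw [abs_of_nonneg hβ0]; push_cast; ring
  refine su3_areaLawOnBallW_bePair (n := 2) (by norm_num) hκ (by rw [hR]; linarith) hmv ?_
  rw [hR]
  have hEh : exp (2 * ε / 2) ≤ 1 + ε + ε ^ 2 / 2 + ε ^ 3 / 6 + 5 / 96 * ε ^ 4 := by
    rw [show 2 * ε / 2 = ε by ring]; exact exp_le_taylor4 hε0 (by linarith)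
  have h := suN_row_lt_one_of_bounds (w := κ / 2) (ε₁ := ε) (q := (4 * βW / 9) / (1 / 2 - 4 * βW / 9))
    (div_nonneg (by positivity) (by linarith)) hε0 hEw (exp_le_taylor4 (by linarith) (by linarith)) hEh hs₀
    (le_sqrt_three_mul hs₀.le hs) hcert
  calc exp (κ / ((2 : ℕ) : ℝ)) * (exp (2 * ε) * (4 * βW / 9) / (1 / 2 - 4 * βW / 9)) +
        exp (2 * ε / 2) * ε / Real.sqrt (((3 : ℕ) : ℝ) * (1 / 2 - 4 * βW / 9))
      = exp (κ / 2) * (exp (2 * ε) * ((4 * βW / 9) / (1 / 2 - 4 * βW / 9))) +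
          exp (2 * ε / 2) * ε / Real.sqrt (((3 : ℕ) : ℝ) * (1 / 2 - 4 * βW / 9)) := by push_cast; ring
    _ < 1 := h

/-- TIER-1 row `(1/4, 0.337)`, `d = 3`, hypothesis-free (`R = 1/9`; `K₁`-vertex row of `AreaLawRowsSU3Free`: `0.322`). [folklore] -/
theorem su3_freePairRow3_1_4 (r : ℕ) {mv : ℕ} (hmv : 1 ≤ mv) :
    AreaLawOnBall 3 3 ((1 / 4 : ℝ) / 3) (2 * (337 / 1000)) (337 / 1000) r mv :=
  su3_freePairRow3 r hmv (s₀ := 10801 / 10000) (by norm_num) (by norm_num) (by norm_num) (by norm_num) (by norm_num)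
    (by norm_num) (by norm_num)

/-- TIER-1 row `(1/3, 0.247)`, `d = 3`, hypothesis-free (`R = 4/27`; `K₁`-vertex row: `0.212`). [folklore] -/
theorem su3_freePairRow3_1_3 (r : ℕ) {mv : ℕ} (hmv : 1 ≤ mv) :
    AreaLawOnBall 3 3 ((1 / 3 : ℝ) / 3) (2 * (247 / 1000)) (247 / 1000) r mv :=
  su3_freePairRow3 r hmv (s₀ := 5137 / 5000) (by norm_num) (by norm_num) (by norm_num) (by norm_num) (by norm_num)
    (by norm_num) (by norm_num)

/-- TIER-1 row `(2/5, 0.176)`, `d = 3`, hypothesis-free (`R = 8/45`; `K₁`-vertex row: `0.130`). [folklore] -/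
theorem su3_freePairRow3_2_5 (r : ℕ) {mv : ℕ} (hmv : 1 ≤ mv) :
    AreaLawOnBall 3 3 ((2 / 5 : ℝ) / 3) (2 * (22 / 125)) (22 / 125) r mv :=
  su3_freePairRow3 r hmv (s₀ := 9831 / 10000) (by norm_num) (by norm_num) (by norm_num) (by norm_num) (by norm_num)
    (by norm_num) (by norm_num)

/-- TIER-1 row `(1/2, 0.069)`, `d = 3`, hypothesis-free (`R = 2/9`; `K_BE`-vertex row: `0.042`). [folklore] -/
theorem su3_freePairRow3_1_2 (r : ℕ) {mv : ℕ} (hmv : 1 ≤ mv) :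
    AreaLawOnBall 3 3 ((1 / 2 : ℝ) / 3) (2 * (69 / 1000)) (69 / 1000) r mv :=
  su3_freePairRow3 r hmv (s₀ := 1141 / 1250) (by norm_num) (by norm_num) (by norm_num) (by norm_num) (by norm_num)
    (by norm_num) (by norm_num)

/-- TIER-2 row `(1/4, log(6/5), 0.319)`, `d = 3`, hypothesis-free. [folklore] -/
theorem su3_freePairRowW3_1_4_w65 {mv : ℕ} (hmv : 1 ≤ mv) :
    AreaLawOnBallW 3 3 ((1 / 4 : ℝ) / 3) (Real.log (6 / 5)) (2 * (319 / 1000)) (319 / 1000) mv :=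
  su3_freePairRowW3 hmv (s₀ := 10801 / 10000) (by norm_num) (by norm_num) (Real.log_pos (by norm_num))
    exp_log_six_fifths_div_two_le (by norm_num) (by norm_num) (by norm_num) (by norm_num) (by norm_num)

/-- TIER-2 row `(1/3, log(6/5), 0.225)`, `d = 3`, hypothesis-free. [folklore] -/
theorem su3_freePairRowW3_1_3_w65 {mv : ℕ} (hmv : 1 ≤ mv) :
    AreaLawOnBallW 3 3 ((1 / 3 : ℝ) / 3) (Real.log (6 / 5)) (2 * (9 / 40)) (9 / 40) mv :=
  su3_freePairRowW3 hmv (s₀ := 5137 / 5000) (by norm_num) (by norm_num) (Real.log_pos (by norm_num))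
    exp_log_six_fifths_div_two_le (by norm_num) (by norm_num) (by norm_num) (by norm_num) (by norm_num)

/-- TIER-2 row `(2/5, log(6/5), 0.152)`, `d = 3`, hypothesis-free. [folklore] -/
theorem su3_freePairRowW3_2_5_w65 {mv : ℕ} (hmv : 1 ≤ mv) :
    AreaLawOnBallW 3 3 ((2 / 5 : ℝ) / 3) (Real.log (6 / 5)) (2 * (19 / 125)) (19 / 125) mv :=
  su3_freePairRowW3 hmv (s₀ := 9831 / 10000) (by norm_num) (by norm_num) (Real.log_pos (by norm_num))
    exp_log_six_fifths_div_two_le (by norm_num) (by norm_num) (by norm_num) (by norm_num) (by norm_num)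

/-- TIER-2 row `(1/2, log(6/5), 0.041)`, `d = 3`, hypothesis-free. [folklore] -/
theorem su3_freePairRowW3_1_2_w65 {mv : ℕ} (hmv : 1 ≤ mv) :
    AreaLawOnBallW 3 3 ((1 / 2 : ℝ) / 3) (Real.log (6 / 5)) (2 * (41 / 1000)) (41 / 1000) mv :=
  su3_freePairRowW3 hmv (s₀ := 1141 / 1250) (by norm_num) (by norm_num) (Real.log_pos (by norm_num))
    exp_log_six_fifths_div_two_le (by norm_num) (by norm_num) (by norm_num) (by norm_num) (by norm_num)

/-! ### 4. Numbers -/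

/-- Numbers at one glance: the squared cross-leg minorants `1.118² ≤ 3·(5/12)`, `1.0801² ≤ 3·(7/18)`, `1.0488² ≤ 3·(11/30)`, `1² ≤ 3·(1/3)`,
`0.9486² ≤ 3·(3/10)`, `0.9128² ≤ 3·(5/18)`, `1.0274² ≤ 3·(19/54)`, `0.9831² ≤ 3·(29/90)`; the weight majorants `1.0627³ ≥ 6/5`, `1.0955² ≥ 6/5`;
radius identities `(2/3)(3/4) = 1/2` and `(4/9)(9/8) = 1/2` (the Bakry–Émery window `R < 1/2` in Wilson units, `d = 4` / `d = 3`). [folklore] -/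
theorem su3_freePairRows_numbers :
    (559 / 500 : ℝ) ^ 2 ≤ 3 * (5 / 12) ∧ (10801 / 10000 : ℝ) ^ 2 ≤ 3 * (7 / 18) ∧ (1311 / 1250 : ℝ) ^ 2 ≤ 3 * (11 / 30) ∧
      (1 : ℝ) ^ 2 ≤ 3 * (1 / 3) ∧ (4743 / 5000 : ℝ) ^ 2 ≤ 3 * (3 / 10) ∧ (1141 / 1250 : ℝ) ^ 2 ≤ 3 * (5 / 18) ∧
      (5137 / 5000 : ℝ) ^ 2 ≤ 3 * (19 / 54) ∧ (9831 / 10000 : ℝ) ^ 2 ≤ 3 * (29 / 90) ∧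
      (1.0627 : ℝ) ^ 3 ≥ 6 / 5 ∧ (1.0955 : ℝ) ^ 2 ≥ 6 / 5 ∧ (2 / 3 : ℝ) * (3 / 4) = 1 / 2 ∧ (4 / 9 : ℝ) * (9 / 8) = 1 / 2 := by
  norm_num

end Summit.Ventures.YMGap.RobustBallSU3

end
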